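import Summits.QuantumFields.BalabanUV.Beta.D1BFx.PairingByParts

/-!
# `BalabanUV.Beta.D1BFx.PairingWardSplit` — road «BF-x» for binder row D1, slot (K), END row `hGrp gN`, «h𝔅₂₂» PART 1: THE PAIRING
# `⟨∇f, A∇g⟩` OF TWO SITE FUNCTIONS THROUGH A LEG WHOSE FREE PART IS THE DIAGONAL COULOMB KERNEL `δ_{ab}·G₀(y−x)` — DOUBLE SUMMATION BY
# PARTS, THE WARD COLLAPSE `Σ_a ∇_a^*∇_a G₀ = δ₀` OF THE FREE PART, AND THE BOUND `Σ'|f·g| + 16·D·(Σ'|f|)(Σ'|g|)` WHEN THE REMAINDER HAS A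
# FLAT MIXED SECOND DIFFERENCE `≤ D` (generic, [folklore]; the instance for the gluon leg `Ga` and the dipoles `δρ` is PART 2 `NeedleDipWardLetter`)

HONEST DEPENDENCY (cell records, verbatim): «continuum YM on T⁴ ⇐ BetaPertH ∧ nine spine estimates (0/9 proved); BetaPertH ⇐ (D1) ∧ (D4) ∧
CAP+tail; G-an2-4 gates asym, D1 and NE2/3/4.»  HONEST FRAMING (cell contract, verbatim): «discharging `BetaPertH` makes Bałaban's UV stability
UNCONDITIONAL — a real constructive-QFT result; it is NOT the continuum limit and NOT the Clay problem.»  THIS MODULE DISCHARGES NOTHING of the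
wall: [folklore] `tsum` bookkeeping BY NAME over leaf-04-g9's three by-parts identities (`PairingByParts.pairing_grad_eq`, `applyK_shift_sub`,
`applyK_grad_eq`) and the Literature's lattice Poisson identity `PoissonInterior.lap_G₀` (`Δ G₀ = −δ₀` on `ℤ⁴`).  No `def`, no `def … : Prop`,
nothing cited, 0 sorry.  The leg `A`, its bound `M`, the flat letter `D` and the two site functions are ABSTRACT here.  Root-level binders hW ∕
hR-sockets ∕ hSX-socket ∕ D1Tel ∕ D1Rep — 0 discharged; (K) NOT closed; NOT D1, NOT `BetaPertH`, NOT continuum, NOT Clay.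

ABSOLUTE RULE (cell charter, verbatim): «No internally-minted statement may enter as a cited fact. Every hypothesis is either kernel-proved in
this package or a verbatim quotation of a PUBLISHED theorem with page reference. The manuscript(s) under audit are NOT citable for their own
disputed steps — they are the thing under adjudication; programme-internal (2001/route/tribunal) claims are never citable.»

WHY (leaf-04-g9 question Q-d1leaf04g9-KK-1, journal 2026-08-21T11:16Z∕11:17Z; owner d1-p2-g11 RULINGS ρ-g11-2∕ρ-g11-3 «`h𝔅₂₂` → leaf-04-g10»).  The
`dip ⊗ dip` cell of T₃ (`NeedleDipDipRow.exists_dipDip_row_le`) displays ONE pairing letter, `|⟨∇δρ_{u,κ}, Ga∇δρ_{v,κ′}⟩| ≤ K𝔅·(n⁻⁴nrm(u−v)⁻² + n⁻⁶)`: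
with the Coulomb letters alone two summations by parts put the leg's mixed second difference `≍ nrm⁻⁴` against two dipoles `≍ n⁻²nrm⁻³`, which is
log-critical in `d = 4`.  The log disappears when the free part of the leg is kept EXACT: the free leg is `δ_{ab}·G₀(y−x)`, so after the two
summations by parts the two lattice gradients act on `G₀` IN THE SAME DIRECTION and sum to `−Δ G₀ = δ₀` — the free part of the pairing is just
`Σ'_x f(x)g(x)` (two dipoles at ONE site: `(3,3) ↦ 2`, super-critical, log-free), and only the REMAINDER `A − δ·G₀` is differenced twice, where its
mixed second difference is FLAT (`≤ D ≍ n⁻⁴` for `Ga`: `DiagonalLegGrade` ∕ `OffDiagonalLegGrade`), costing `D·(Σ'|f|)(Σ'|g|) ≍ n⁻⁶`.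

CONTENT (`D = 4`; `A : MKer 4 (Fin 4)` with `|A| ≤ M`; `f g : ℤ⁴ → ℝ` absolutely summable).
* §1 [folklore] summability helpers (`summable_mul_of_abs_le`, `summable_mul_of_abs_le'`, `summable_abs_shift`, `tsum_abs_shift`, `sum_abs_grad_le`,
  `abs_applyK_grad_le_of_bdd`: `|(A∇g)(x,c)| ≤ 8·M·Σ'|g|`).
* §2 [folklore] **`pairing_grad_applyK_grad_eq`** — DOUBLE BY PARTS: `⟨∇f, A∇g⟩ = Σ'_x Σ_a f(x)·(D²A g)(x,a)`,
  `D²A(x,y)_{ab} = A(x−e_a,y−e_b) − A(x,y−e_b) − A(x−e_a,y) + A(x,y)`.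
* §3 [folklore] **`sum_lapDiff_G₀_eq`** — `Σ_a (2G₀(z) − G₀(z−e_a) − G₀(z+e_a)) = [z = 0]` (`lap_G₀`), and **`tsum_lapDiff_G₀_mul_eq`** — the Ward collapse
  `Σ'_y (Σ_a …)(y−x)·g(y) = g(x)`.
* §4 [folklore] **`abs_pairing_grad_applyK_grad_le`** — if `|D²A(x,y)_{ab} − [a=b]·(2G₀(y−x) − G₀(y−x−e_a) − G₀(y−x+e_a))| ≤ D` everywhere then
  `|⟨∇f, A∇g⟩| ≤ Σ'_x |f(x)g(x)| + 16·D·(Σ'|f|)·(Σ'|g|)`.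
Unit `b2b-balaban-beta-d1-formalise-leaf-04` (gen 10); `LEAVES-BFx.md` row (N) «h𝔅₂₂» PART 1.
-/

noncomputable section

namespace Summit.QuantumFields.BalabanUV.Beta.D1BFx.PairingWardSplit

open Finset
open scoped BigOperators
open Literature.MathematicalPhysics.QuantumFieldTheory.Balaban1983to89
open Literature.MathematicalPhysics.QuantumFieldTheory.Balaban1983to89.Beta
open Literature.Probability.LatticeModels (latticeLaplacianZd latticeLaplacianZd_def)
open ExpKernelCalculus (Site MKer)
open AffineAveraging (unitVec)
open PoissonInterior (G₀ lap_G₀)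
open Summit.QuantumFields.BalabanUV.Beta.D1BFx.RankOneBubble (applyK pairing applyK_apply pairing_def)
open Summit.QuantumFields.BalabanUV.Beta.D1BFx.RankOneBubbleJets (grad grad_apply)
open Summit.QuantumFields.BalabanUV.Beta.D1BFx.LatticeHLSProfiles (summable_and_abs_tsum_le_of_abs_sum_le)
open Summit.QuantumFields.BalabanUV.Beta.D1BFx.PairingByParts (applyK_grad_eq pairing_grad_eq applyK_shift_sub)

variable {A : MKer 4 (Fin 4)} {f g : Site 4 → ℝ} {M : ℝ}

/-! ## §1 Summability from a bounded factor -/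

/-- [folklore] bounded × absolutely summable ⇒ summable. -/
theorem summable_mul_of_abs_le {K h : Site 4 → ℝ} {B : ℝ} (hK : ∀ y, |K y| ≤ B) (hh : Summable fun y => |h y|) :
    Summable fun y => K y * h y :=
  Summable.of_norm_bounded (hh.mul_left B) fun y => by
    rw [Real.norm_eq_abs, abs_mul]; exact mul_le_mul_of_nonneg_right (hK y) (abs_nonneg _)

/-- [folklore] absolutely summable × bounded ⇒ summable. -/
theorem summable_mul_of_abs_le' {K h : Site 4 → ℝ} {B : ℝ} (hK : ∀ y, |K y| ≤ B) (hh : Summable fun y => |h y|) :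
    Summable fun y => h y * K y :=
  (summable_mul_of_abs_le hK hh).congr fun _ => mul_comm _ _

/-- [folklore] a shift of an absolutely summable site function is absolutely summable … -/
theorem summable_abs_shift (hg : Summable fun y => |g y|) (e : Site 4) : Summable fun y => |g (y + e)| := by
  exact ((Equiv.addRight e).summable_iff.mpr hg).congr fun _ => rfl

/-- [folklore] … with the same sum. -/
theorem tsum_abs_shift (g : Site 4 → ℝ) (e : Site 4) : ∑' y, |g (y + e)| = ∑' y, |g y| := by
  have h := (Equiv.addRight e).tsum_eq (fun y => |g y|)
  simpa only [Equiv.coe_addRight] using h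

/-- [folklore] a finite piece of the gradient's ℓ¹ norm: `Σ_{y∈S} |∇g(y,b)| ≤ 2·Σ'|g|`. -/
theorem sum_abs_grad_le (hg : Summable fun y => |g y|) (S : Finset (Site 4)) (b : Fin 4) :
    ∑ y ∈ S, |grad g y b| ≤ 2 * ∑' y, |g y| := by
  have h1 : ∑ y ∈ S, |g (y + unitVec b)| ≤ ∑' y, |g y| := by
    rw [← tsum_abs_shift g (unitVec b)]
    exact (summable_abs_shift hg _).sum_le_tsum S (fun _ _ => abs_nonneg _)
  have h2 : ∑ y ∈ S, |g y| ≤ ∑' y, |g y| := hg.sum_le_tsum S (fun _ _ => abs_nonneg _)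
  calc ∑ y ∈ S, |grad g y b| ≤ ∑ y ∈ S, (|g (y + unitVec b)| + |g y|) :=
        Finset.sum_le_sum fun y _ => by rw [grad_apply]; exact abs_sub _ _
    _ = ∑ y ∈ S, |g (y + unitVec b)| + ∑ y ∈ S, |g y| := Finset.sum_add_distrib
    _ ≤ _ := by linarith

/-- [folklore] the gradient of an absolutely summable site function is absolutely summable in each fibre. -/
theorem summable_abs_grad (hg : Summable fun y => |g y|) (b : Fin 4) : Summable fun y => |grad g y b| :=
  Summable.of_nonneg_of_le (fun _ => abs_nonneg _) (fun y => by rw [grad_apply]; exact abs_sub _ _)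
    ((summable_abs_shift hg (unitVec b)).add hg)

/-- [folklore] **A BOUNDED LEG ON THE GRADIENT OF AN ℓ¹ SITE FUNCTION IS BOUNDED**: `|(A∇g)(x,c)| ≤ 8·M·Σ'|g|`. -/
theorem abs_applyK_grad_le_of_bdd (hA : ∀ x y c b, |A x y c b| ≤ M) (hg : Summable fun y => |g y|) (x : Site 4) (c : Fin 4) :
    |applyK A (grad g) x c| ≤ 8 * M * ∑' y, |g y| := by
  rw [applyK_apply]
  have hM : 0 ≤ M := (abs_nonneg _).trans (hA x x c c)
  refine (summable_and_abs_tsum_le_of_abs_sum_le fun S => ?_).2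
  calc ∑ y ∈ S, |∑ b, A x y c b * grad g y b| ≤ ∑ y ∈ S, ∑ b, M * |grad g y b| := by
        refine Finset.sum_le_sum fun y _ => (Finset.abs_sum_le_sum_abs _ _).trans (Finset.sum_le_sum fun b _ => ?_)
        rw [abs_mul]; exact mul_le_mul_of_nonneg_right (hA x y c b) (abs_nonneg _)
    _ = ∑ b, M * ∑ y ∈ S, |grad g y b| := by rw [Finset.sum_comm]; simp only [Finset.mul_sum]
    _ ≤ ∑ _b : Fin 4, M * (2 * ∑' y, |g y|) := Finset.sum_le_sum fun b _ => mul_le_mul_of_nonneg_left (sum_abs_grad_le hg S b) hM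
    _ = 8 * M * ∑' y, |g y| := by rw [Finset.sum_const, Finset.card_univ, Fintype.card_fin, nsmul_eq_mul]; push_cast; ring

/-! ## §2 Double summation by parts -/

/-- [folklore] **DOUBLE BY PARTS**: for a bounded leg and two absolutely summable site functions,
`⟨∇f, A∇g⟩ = Σ'_x Σ_a f(x)·Σ'_y Σ_b D²A(x,y)_{ab}·g(y)` with `D²A(x,y)_{ab} = A(x−e_a,y−e_b) − A(x,y−e_b) − A(x−e_a,y) + A(x,y)`
(`pairing_grad_eq`, then `applyK_shift_sub`, then `applyK_grad_eq` on the differenced leg). -/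
theorem pairing_grad_applyK_grad_eq (hA : ∀ x y c b, |A x y c b| ≤ M) (hf : Summable fun x => |f x|) (hg : Summable fun y => |g y|) :
    pairing (grad f) (applyK A (grad g)) =
      pairing (fun x (_ : Fin 4) => f x) (fun x a => applyK
        (fun x y a b => (A (x - unitVec a) (y - unitVec b) a b - A x (y - unitVec b) a b) - (A (x - unitVec a) y a b - A x y a b))
        (fun y (_ : Fin 4) => g y) x a) := by
  have hχ := abs_applyK_grad_le_of_bdd hA hg
  have hgg := summable_abs_grad hg
  rw [pairing_grad_eq f (applyK A (grad g)) (fun a => summable_mul_of_abs_le' (fun x => hχ x a) hf)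
    (fun a => summable_mul_of_abs_le' (fun x => hχ (x - unitVec a) a) hf)]
  congr 1
  funext x a
  have h2M : ∀ (x' y : Site 4) (b : Fin 4), |A (x' - unitVec a) y a b - A x' y a b| ≤ M + M := fun x' y b =>
    (abs_sub _ _).trans (add_le_add (hA _ _ _ _) (hA _ _ _ _))
  rw [applyK_shift_sub A (grad g) x a (fun b => summable_mul_of_abs_le (fun y => hA x y a b) (hgg b))
      (fun b => summable_mul_of_abs_le (fun y => hA (x - unitVec a) y a b) (hgg b)),
    applyK_grad_eq (fun x y a b => A (x - unitVec a) y a b - A x y a b) g x a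
      (fun b => summable_mul_of_abs_le (fun y => h2M x y b) hg) (fun b => summable_mul_of_abs_le (fun y => h2M x (y - unitVec b) b) hg)]

/-! ## §3 The Ward collapse of the free part -/

/-- [folklore] **`Σ_a (2G₀(z) − G₀(z−e_a) − G₀(z+e_a)) = −(Δ G₀)(z) = [z = 0]`** on `ℤ⁴` (`PoissonInterior.lap_G₀`). -/
theorem sum_lapDiff_G₀_eq (z : Site 4) :
    ∑ a : Fin 4, (2 * G₀ z - G₀ (z - unitVec a) - G₀ (z + unitVec a)) = if z = 0 then 1 else 0 := by
  have h := lap_G₀ (d := 4) (by norm_num) z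
  rw [latticeLaplacianZd_def] at h
  have e : ∑ a : Fin 4, (2 * G₀ z - G₀ (z - unitVec a) - G₀ (z + unitVec a))
      = -(∑ i : Fin 4, (G₀ (z + Pi.single i 1) + G₀ (z - Pi.single i 1)) - 2 * (4 : ℕ) * G₀ z) := by
    simp only [unitVec, Finset.sum_sub_distrib, Finset.sum_add_distrib, Finset.sum_const, Finset.card_univ, Fintype.card_fin, nsmul_eq_mul]
    push_cast; ring
  rw [e, h]
  split_ifs <;> simp

/-- [folklore] **THE WARD COLLAPSE**: for an absolutely summable `g`, `Σ'_y (Σ_a (2G₀(y−x) − G₀(y−x−e_a) − G₀(y−x+e_a)))·g(y) = g(x)`. -/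
theorem tsum_lapDiff_G₀_mul_eq (g : Site 4 → ℝ) (x : Site 4) :
    ∑' y, (∑ a : Fin 4, (2 * G₀ (y - x) - G₀ (y - x - unitVec a) - G₀ (y - x + unitVec a))) * g y = g x := by
  have e : ∀ y : Site 4, (∑ a : Fin 4, (2 * G₀ (y - x) - G₀ (y - x - unitVec a) - G₀ (y - x + unitVec a))) * g y
      = if y = x then g y else 0 := fun y => by
    rw [sum_lapDiff_G₀_eq (y - x)]
    by_cases hy : y = x
    · simp [hy]
    · have : y - x ≠ 0 := sub_ne_zero.mpr hy
      simp [hy, this]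
  rw [tsum_congr e, tsum_ite_eq]

/-! ## §4 The bound -/

/-- [folklore] **THE WARD-SPLIT BOUND**: `A` bounded by `M`, `f`, `g` absolutely summable, and the mixed second difference of `A` equal to the
free one `[a=b]·(2G₀(y−x) − G₀(y−x−e_a) − G₀(y−x+e_a))` up to a FLAT error `≤ D` ⇒
`|⟨∇f, A∇g⟩| ≤ Σ'_x |f(x)·g(x)| + 16·D·(Σ'_x|f(x)|)·(Σ'_y|g(y)|)`. -/
theorem abs_pairing_grad_applyK_grad_le (hA : ∀ x y c b, |A x y c b| ≤ M) (hf : Summable fun x => |f x|) (hg : Summable fun y => |g y|)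
    {D : ℝ} (hR : ∀ (x y : Site 4) (a b : Fin 4),
      |((A (x - unitVec a) (y - unitVec b) a b - A x (y - unitVec b) a b) - (A (x - unitVec a) y a b - A x y a b))
        - (if a = b then 2 * G₀ (y - x) - G₀ (y - x - unitVec a) - G₀ (y - x + unitVec a) else 0)| ≤ D) :
    |pairing (grad f) (applyK A (grad g))| ≤ (∑' x, |f x * g x|) + 16 * D * (∑' x, |f x|) * ∑' y, |g y| := by
  have hD : 0 ≤ D := (abs_nonneg _).trans (hR 0 0 0 0)
  have hTg : 0 ≤ ∑' y, |g y| := tsum_nonneg fun _ => abs_nonneg _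
  obtain ⟨C₀, hC₀, hG₀⟩ := PoissonInterior.G₀_bound (d := 4) (by norm_num)
  have hG : ∀ v : Site 4, |G₀ v| ≤ C₀ := fun v => (hG₀ v).trans (PoissonInterior.div_nrm_pow_le hC₀ v _)
  rw [pairing_grad_applyK_grad_eq hA hf hg, pairing_def]
  -- names: the free second difference `P`, the mixed second difference `Q`, the remainder `W = Q − [a=b]·P`
  set P : Site 4 → Site 4 → Fin 4 → ℝ := fun x y a => 2 * G₀ (y - x) - G₀ (y - x - unitVec a) - G₀ (y - x + unitVec a) with hP
  set Q : Site 4 → Site 4 → Fin 4 → Fin 4 → ℝ := fun x y a b =>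
    (A (x - unitVec a) (y - unitVec b) a b - A x (y - unitVec b) a b) - (A (x - unitVec a) y a b - A x y a b) with hQ
  have hW : ∀ x y a b, |Q x y a b - (if a = b then P x y a else 0)| ≤ D := fun x y a b => by
    simp only [hQ, hP]; exact hR x y a b
  have hPb : ∀ x y a, |P x y a| ≤ 4 * C₀ := fun x y a => by
    simp only [hP]
    calc |2 * G₀ (y - x) - G₀ (y - x - unitVec a) - G₀ (y - x + unitVec a)|
        ≤ |2 * G₀ (y - x) - G₀ (y - x - unitVec a)| + |G₀ (y - x + unitVec a)| := abs_sub _ _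
      _ ≤ |2 * G₀ (y - x)| + |G₀ (y - x - unitVec a)| + |G₀ (y - x + unitVec a)| := by gcongr; exact abs_sub _ _
      _ ≤ 2 * C₀ + C₀ + C₀ := by
          rw [abs_mul, abs_two]
          exact add_le_add (add_le_add (mul_le_mul_of_nonneg_left (hG _) (by norm_num)) (hG _)) (hG _)
      _ = 4 * C₀ := by ring
  -- the inner tsum splits into the free part and the remainder
  have hsplit : ∀ (x : Site 4) (a : Fin 4),
      applyK Q (fun y (_ : Fin 4) => g y) x a = (∑' y, P x y a * g y) + ∑' y, ∑ b, (Q x y a b - (if a = b then P x y a else 0)) * g y := by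
    intro x a
    rw [applyK_apply]
    have s1 : Summable fun y => P x y a * g y := summable_mul_of_abs_le (fun y => hPb x y a) hg
    have s2 : Summable fun y => ∑ b, (Q x y a b - (if a = b then P x y a else 0)) * g y :=
      summable_sum fun b _ => summable_mul_of_abs_le (fun y => hW x y a b) hg
    rw [← s1.tsum_add s2]
    refine tsum_congr fun y => ?_
    have e : ∀ b : Fin 4, Q x y a b * g y = (if a = b then P x y a * g y else 0) + (Q x y a b - (if a = b then P x y a else 0)) * g y := by
      intro b; split_ifs <;> ring
    rw [Finset.sum_congr rfl fun b _ => e b, Finset.sum_add_distrib, Finset.sum_ite_eq]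
    simp
  -- the free parts sum over `a` to `g x`
  have hfree : ∀ x : Site 4, ∑ a : Fin 4, ∑' y, P x y a * g y = g x := by
    intro x
    rw [← Summable.tsum_finsetSum (fun a _ => summable_mul_of_abs_le (fun y => hPb x y a) hg)]
    simp only [← Finset.sum_mul, hP]
    exact tsum_lapDiff_G₀_mul_eq g x
  -- the remainder is bounded by `4·D·Σ'|g|` in each fibre
  have hrem : ∀ (x : Site 4) (a : Fin 4), |∑' y, ∑ b, (Q x y a b - (if a = b then P x y a else 0)) * g y| ≤ 4 * D * ∑' y, |g y| := by
    intro x a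
    refine (summable_and_abs_tsum_le_of_abs_sum_le fun S => ?_).2
    calc ∑ y ∈ S, |∑ b, (Q x y a b - (if a = b then P x y a else 0)) * g y| ≤ ∑ y ∈ S, ∑ _b : Fin 4, D * |g y| := by
          refine Finset.sum_le_sum fun y _ => (Finset.abs_sum_le_sum_abs _ _).trans (Finset.sum_le_sum fun b _ => ?_)
          rw [abs_mul]; exact mul_le_mul_of_nonneg_right (hW x y a b) (abs_nonneg _)
      _ = 4 * D * ∑ y ∈ S, |g y| := by
          simp only [Finset.sum_const, Finset.card_univ, Fintype.card_fin, nsmul_eq_mul, Finset.mul_sum]; push_cast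
          exact Finset.sum_congr rfl fun y _ => by ring
      _ ≤ 4 * D * ∑' y, |g y| := mul_le_mul_of_nonneg_left (hg.sum_le_tsum S (fun _ _ => abs_nonneg _)) (by positivity)
  -- pointwise in `x`: the fibre sum is `f x · g x` plus a remainder of size `16·D·Σ'|g|·|f x|`
  have hpt : ∀ x : Site 4, |∑ a : Fin 4, f x * applyK Q (fun y (_ : Fin 4) => g y) x a| ≤ |f x * g x| + 16 * D * (∑' y, |g y|) * |f x| := by
    intro x
    have e : ∑ a : Fin 4, f x * applyK Q (fun y (_ : Fin 4) => g y) x a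
        = f x * g x + f x * ∑ a : Fin 4, ∑' y, ∑ b, (Q x y a b - (if a = b then P x y a else 0)) * g y := by
      rw [← Finset.mul_sum, Finset.sum_congr rfl fun a _ => hsplit x a, Finset.sum_add_distrib, hfree x]; ring
    rw [e]
    refine (abs_add_le _ _).trans (add_le_add le_rfl ?_)
    rw [abs_mul]
    have h4 : |∑ a : Fin 4, ∑' y, ∑ b, (Q x y a b - (if a = b then P x y a else 0)) * g y| ≤ 16 * D * ∑' y, |g y| := by
      refine (Finset.abs_sum_le_sum_abs _ _).trans ?_
      calc ∑ a : Fin 4, |∑' y, ∑ b, (Q x y a b - (if a = b then P x y a else 0)) * g y| ≤ ∑ _a : Fin 4, 4 * D * ∑' y, |g y| :=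
            Finset.sum_le_sum fun a _ => hrem x a
        _ = 16 * D * ∑' y, |g y| := by rw [Finset.sum_const, Finset.card_univ, Fintype.card_fin, nsmul_eq_mul]; push_cast; ring
    calc |f x| * |∑ a : Fin 4, ∑' y, ∑ b, (Q x y a b - (if a = b then P x y a else 0)) * g y|
        ≤ |f x| * (16 * D * ∑' y, |g y|) := mul_le_mul_of_nonneg_left h4 (abs_nonneg _)
      _ = 16 * D * (∑' y, |g y|) * |f x| := by ring
  -- `|f·g|` is summable (g is bounded by its ℓ¹ norm)
  have hgb : ∀ x, |g x| ≤ ∑' y, |g y| := fun x => hg.le_tsum x (fun _ _ => abs_nonneg _)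
  have hfg : Summable fun x => |f x * g x| :=
    Summable.of_nonneg_of_le (fun _ => abs_nonneg _) (fun x => by
      rw [abs_mul, mul_comm]; exact mul_le_mul_of_nonneg_right (hgb x) (abs_nonneg _)) (hf.mul_left (∑' y, |g y|))
  refine (summable_and_abs_tsum_le_of_abs_sum_le fun S => ?_).2
  calc ∑ x ∈ S, |∑ a : Fin 4, (fun (x : Site 4) (_ : Fin 4) => f x) x a * applyK Q (fun y (_ : Fin 4) => g y) x a|
      ≤ ∑ x ∈ S, (|f x * g x| + 16 * D * (∑' y, |g y|) * |f x|) := Finset.sum_le_sum fun x _ => hpt x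
    _ = ∑ x ∈ S, |f x * g x| + 16 * D * (∑' y, |g y|) * ∑ x ∈ S, |f x| := by rw [Finset.sum_add_distrib, Finset.mul_sum]
    _ ≤ (∑' x, |f x * g x|) + 16 * D * (∑' y, |g y|) * ∑' x, |f x| :=
        add_le_add (hfg.sum_le_tsum S (fun _ _ => abs_nonneg _))
          (mul_le_mul_of_nonneg_left (hf.sum_le_tsum S (fun _ _ => abs_nonneg _)) (by positivity))
    _ = _ := by ring

end Summit.QuantumFields.BalabanUV.Beta.D1BFx.PairingWardSplit

end
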